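import Literature.AlgebraicGeometry.Resolution.FibreCone
import HarnessLib

/-!
# [OURS · L1 W4.2] The substitution `𝒪[Y_1, …, Y_n] → 𝒪[𝔭t]`, `Y_l ↦ c_l t`, into the Rees ring of a centre
# `𝔭 = (c_1, …, c_n)`: forms of degree `m` go to `G(c) tᵐ`, and `𝔫𝒪[𝔭t]` read coefficientwise
# (campaign s42, cell res-hironaka; informal crux `RidgeConfinement`, stmt-ResolutionOfSingularities-17845; `--supports`)

HONEST FRAMING. OURS (slot W4.2, prover res-L1-s42-pv-1, gen 3): elementary bookkeeping on the tree's Rees ring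
`ReesRing 𝔭 = 𝒪[𝔭t]` (`FibreCone.lean`) needed to present the fibre cone `gr_𝔭(𝒪) ⊗ k = 𝒪[𝔭t]/𝔫𝒪[𝔭t]` by polynomials
(companion file `…CampaignW42FibreConePresentation.lean`):

* `CampaignW42.reesGen c l = c_l t`, `CampaignW42.reesPolyMap c : 𝒪[Y] → 𝒪[𝔭t]` (`Y_l ↦ c_l t`), `CampaignW42.polyHom`
  (`ReesRing.poly` bundled as a ring homomorphism `𝒪[𝔭t] → 𝒪[X]`);
* `poly_reesPolyMap` / `poly_reesPolyMap_of_isHomogeneous` / `reesPolyMap_eq_tMonomial`: a form `G` of degree `m` goes to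
  `G(c) tᵐ` (so `G(c) ∈ 𝔭ᵐ`, `eval_mem_pow_of_isHomogeneous`); `constCoeff_reesPolyMap`;
* `mem_reesMaxExt_iff_coeff`: **`b ∈ 𝔫𝒪[𝔭t]` iff every coefficient `b_m ∈ 𝔫𝔭ᵐ`** (the kernel of
  `𝒪[𝔭t] → gr_𝔭 𝒪 ⊗ k` is graded).

NOTHING here is a statement of H. Hironaka's manuscript [Hironaka2017]. AI review is weaker than expert review.
References (orientation only): D. Eisenbud, *Commutative Algebra*, §5.2 (the Rees algebra); V. Cossart, U. Jannsen,
S. Saito, LNM 2270 (2020), proof of Thm. 3.10 (p. 46).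
-/

noncomputable section

-- single-conjunct summit: the doubled namespace component `ResolutionOfSingularities` is mandated
set_option linter.dupNamespace false

open IsLocalRing MvPolynomial
open Literature.RingTheory.HilbertSamuel
open Literature.AlgebraicGeometry.Resolution

namespace Summit.ResolutionOfSingularities.ResolutionOfSingularities.Theorems

namespace CampaignW42

universe u

/-! ## The Rees ring: generators `c_l t` and the substitution `Y_l ↦ c_l t` -/

section Rees

variable {O : Type u} [CommRing O] {n : ℕ} (c : Fin n → O)

local notation3 "𝔭" => Ideal.span (Set.range c)

/-- `c_l ∈ 𝔭¹`. [folklore] -/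
theorem mem_span_range_pow_one (l : Fin n) : c l ∈ (𝔭) ^ 1 := by
  rw [pow_one]; exact Ideal.subset_span ⟨l, rfl⟩

/-- [OURS · L1 W4.2] The degree-one generator `c_l t ∈ 𝒪[𝔭t]` of the Rees ring of `𝔭 = (c_1, …, c_n)`. NOT a statement of
the manuscript. [folklore] -/
def reesGen (l : Fin n) : ReesRing (𝔭) := ReesRing.tMonomial (𝔭) 1 (c l) (mem_span_range_pow_one c l)

/-- `poly (c_l t) = c_l X`. [folklore] -/
@[simp] theorem poly_reesGen (l : Fin n) : ReesRing.poly (𝔭) (reesGen c l) = Polynomial.monomial 1 (c l) := rfl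

/-- [OURS · L1 W4.2] The substitution `𝒪[Y_1, …, Y_n] → 𝒪[𝔭t]`, `Y_l ↦ c_l t` (a surjection onto the Rees ring). NOT a
statement of the manuscript. [folklore] -/
def reesPolyMap : MvPolynomial (Fin n) O →+* ReesRing (𝔭) :=
  eval₂Hom (algebraMap O (ReesRing (𝔭))) (reesGen c)

/-- `ReesRing.poly` as a ring homomorphism `𝒪[𝔭t] → 𝒪[X]`. [folklore] -/
def polyHom : ReesRing (𝔭) →+* Polynomial O where
  toFun := ReesRing.poly (𝔭)
  map_one' := ReesRing.poly_one (𝔭)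
  map_mul' := ReesRing.poly_mul (𝔭)
  map_zero' := ReesRing.poly_zero (𝔭)
  map_add' := ReesRing.poly_add (𝔭)

/-- `polyHom` is `poly`. [folklore] -/
@[simp] theorem polyHom_apply (b : ReesRing (𝔭)) : polyHom c b = ReesRing.poly (𝔭) b := rfl

/-- A product of monomials is a monomial. [folklore] -/
theorem finset_prod_monomial_one_pow (s : Finset (Fin n)) (α : Fin n → ℕ) (a : Fin n → O) :
    ∏ l ∈ s, Polynomial.monomial 1 (a l) ^ α l = Polynomial.monomial (∑ l ∈ s, α l) (∏ l ∈ s, a l ^ α l) := by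
  classical
  induction s using Finset.induction_on with
  | empty => simp
  | insert i s hi ih =>
    rw [Finset.prod_insert hi, Finset.prod_insert hi, Finset.sum_insert hi, ih, Polynomial.monomial_pow,
      Polynomial.monomial_mul_monomial, one_mul]

/-- A product of monomials is a monomial (`Finsupp.prod` form). [folklore] -/
theorem finsupp_prod_monomial (α : Fin n →₀ ℕ) (a : Fin n → O) :
    (α.prod fun l e => (Polynomial.monomial 1 (a l)) ^ e) =
      Polynomial.monomial (α.sum fun _ e => e) (α.prod fun l e => a l ^ e) := by
  unfold Finsupp.prod Finsupp.sum
  exact finset_prod_monomial_one_pow α.support α a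

/-- **`poly` of the image of a polynomial**: `poly(G(c t)) = G` with `Y_l ↦ c_l X`. [folklore] -/
theorem poly_reesPolyMap (G : MvPolynomial (Fin n) O) :
    ReesRing.poly (𝔭) (reesPolyMap c G) = eval₂ Polynomial.C (fun l => Polynomial.monomial 1 (c l)) G := by
  change polyHom c (reesPolyMap c G) = _
  rw [reesPolyMap, ← RingHom.comp_apply, comp_eval₂Hom, coe_eval₂Hom]
  congr 1

/-- **A form `G` of degree `m` goes to `G(c) tᵐ`**: `poly(G(c t)) = G(c) Xᵐ`. [folklore] -/
theorem poly_reesPolyMap_of_isHomogeneous {G : MvPolynomial (Fin n) O} {m : ℕ} (hG : G.IsHomogeneous m) :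
    ReesRing.poly (𝔭) (reesPolyMap c G) = Polynomial.monomial m (eval c G) := by
  classical
  rw [poly_reesPolyMap]
  conv_lhs => rw [G.as_sum, eval₂_sum]
  conv_rhs => rw [G.as_sum, map_sum, map_sum]
  refine Finset.sum_congr rfl fun α hα => ?_
  rw [eval₂_monomial, finsupp_prod_monomial, Polynomial.C_mul_monomial, eval_monomial]
  have h := hG (mem_support_iff.mp hα)
  simp only [Finsupp.weight_apply, Pi.one_apply, smul_eq_mul, mul_one] at h
  rw [h]

/-- The coefficient `G(c)` of a form of degree `m` lies in `𝔭ᵐ`. [folklore] -/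
theorem eval_mem_pow_of_isHomogeneous {G : MvPolynomial (Fin n) O} {m : ℕ} (hG : G.IsHomogeneous m) :
    eval c G ∈ (𝔭) ^ m := by
  have h := ReesRing.coeff_poly_mem (𝔭) (reesPolyMap c G) m
  rwa [poly_reesPolyMap_of_isHomogeneous c hG, Polynomial.coeff_monomial, if_pos rfl] at h

/-- **`G(c t) = G(c) tᵐ`** in `𝒪[𝔭t]` for a form `G` of degree `m`. [folklore] -/
theorem reesPolyMap_eq_tMonomial {G : MvPolynomial (Fin n) O} {m : ℕ} (hG : G.IsHomogeneous m) :
    reesPolyMap c G = ReesRing.tMonomial (𝔭) m (eval c G) (eval_mem_pow_of_isHomogeneous c hG) :=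
  ReesRing.ext (𝔭) (by rw [poly_reesPolyMap_of_isHomogeneous c hG, ReesRing.poly_tMonomial])

/-- The augmentation of `G(c t)` is the constant coefficient of `G`. [folklore] -/
theorem constCoeff_reesPolyMap (G : MvPolynomial (Fin n) O) :
    ReesRing.constCoeff (𝔭) (reesPolyMap c G) = constantCoeff G := by
  rw [reesPolyMap, ← RingHom.comp_apply, comp_eval₂Hom]
  have h0 : (fun l => ReesRing.constCoeff (𝔭) (reesGen c l)) = (0 : Fin n → O) := by
    funext l
    rw [ReesRing.constCoeff_apply, poly_reesGen, Polynomial.coeff_monomial, if_neg one_ne_zero]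
    rfl
  have h1 : (ReesRing.constCoeff (𝔭)).comp (algebraMap O (ReesRing (𝔭))) = RingHom.id O :=
    RingHom.ext fun r => ReesRing.constCoeff_algebraMap (𝔭) r
  rw [h0, h1, eval₂Hom_zero_apply, RingHom.id_apply]

end Rees

/-! ## `𝔫 𝒪[𝔭t]` coefficientwise -/

section MaxExt

variable {O : Type u} [CommRing O] [IsLocalRing O] (𝔭 : Ideal O)

/-- The coefficients of an element of `𝔫𝒪[𝔭t]` lie in `𝔫𝔭ᵐ`. [folklore] -/
theorem coeff_mem_of_mem_reesMaxExt {b : ReesRing 𝔭} (hb : b ∈ reesMaxExt 𝔭) (m : ℕ) :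
    (ReesRing.poly 𝔭 b).coeff m ∈ maximalIdeal O * 𝔭 ^ m := by
  revert m
  refine Submodule.span_induction ?_ ?_ ?_ ?_ hb
  · rintro x ⟨y, hy, rfl⟩ m
    rw [ReesRing.poly_algebraMap, Polynomial.coeff_C]
    split_ifs with h
    · subst h; rw [pow_zero, Ideal.one_eq_top, Ideal.mul_top]; exact hy
    · exact zero_mem _
  · intro m; simp
  · intro x y _ _ hx hy m
    rw [ReesRing.poly_add, Polynomial.coeff_add]
    exact add_mem (hx m) (hy m)
  · intro r x _ hx m
    rw [smul_eq_mul, ReesRing.poly_mul, Polynomial.coeff_mul]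
    refine Ideal.sum_mem _ fun ij hij => ?_
    have hij' : ij.1 + ij.2 = m := Finset.HasAntidiagonal.mem_antidiagonal.mp hij
    have h := Ideal.mul_mem_mul (ReesRing.coeff_poly_mem 𝔭 r ij.1) (hx ij.2)
    have heq : 𝔭 ^ ij.1 * (maximalIdeal O * 𝔭 ^ ij.2) = maximalIdeal O * 𝔭 ^ m := by
      rw [mul_left_comm, ← pow_add, hij']
    rwa [heq] at h

/-- Conversely `x tᵐ ∈ 𝔫𝒪[𝔭t]` for `x ∈ 𝔫𝔭ᵐ`. [folklore] -/
theorem tMonomial_mem_reesMaxExt {m : ℕ} {x : O} (hx : x ∈ maximalIdeal O * 𝔭 ^ m) (hx' : x ∈ 𝔭 ^ m) :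
    ReesRing.tMonomial 𝔭 m x hx' ∈ reesMaxExt 𝔭 := by
  have key : ∀ y, y ∈ maximalIdeal O * 𝔭 ^ m →
      ∃ hy : y ∈ 𝔭 ^ m, ReesRing.tMonomial 𝔭 m y hy ∈ reesMaxExt 𝔭 := by
    intro y hy
    refine Submodule.mul_induction_on hy ?_ ?_
    · intro a ha z hz
      refine ⟨Ideal.mul_mem_left _ a hz, ?_⟩
      rw [ReesRing.tMonomial_mul_left 𝔭 m a z hz]
      exact Ideal.mul_mem_right _ _ (Ideal.mem_map_of_mem _ ha)
    · rintro a z ⟨ha, ha'⟩ ⟨hz, hz'⟩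
      refine ⟨add_mem ha hz, ?_⟩
      rw [ReesRing.tMonomial_add 𝔭 m a z ha hz]
      exact add_mem ha' hz'
  obtain ⟨_, h'⟩ := key x hx
  exact h'

/-- **`b ∈ 𝔫𝒪[𝔭t]` iff every coefficient `b_m` lies in `𝔫𝔭ᵐ`** (the kernel of `𝒪[𝔭t] → gr_𝔭 𝒪 ⊗ k` is graded).
[folklore] -/
theorem mem_reesMaxExt_iff_coeff (b : ReesRing 𝔭) :
    b ∈ reesMaxExt 𝔭 ↔ ∀ m, (ReesRing.poly 𝔭 b).coeff m ∈ maximalIdeal O * 𝔭 ^ m := by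
  refine ⟨coeff_mem_of_mem_reesMaxExt 𝔭, fun h => ?_⟩
  rw [← ReesRing.sum_tMonomial_coeff 𝔭 b]
  exact Ideal.sum_mem _ fun m _ => tMonomial_mem_reesMaxExt 𝔭 (h m) _

end MaxExt

end CampaignW42

end Summit.ResolutionOfSingularities.ResolutionOfSingularities.Theorems

end
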